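import Mathlib

/-!
# A kernel-checked counterexample to the «unnormalised slack monotonicity» (c) / (KMONO)
(blind cell PercRepro2, seat mine-1 g30; record conjectures/MINE-1.md §41)

For Bernoulli bond percolation on a finite graph with root `s`, an avoided vertex set `X`,
`R_X := {C_s ∩ X = ∅}` and increasing functions `F, G` of the open cluster `C_s`, put

  `K_X := P(R_X) · Cov(F, G | R_X) = E[FG; R_X] − E[F; R_X]·E[G; R_X] / P(R_X)`

(the *unnormalised conditional BHK slack*; `K_X ≥ 0` is van den Berg–Häggström–Kahn 2006,
Theorem 1.3).  The cell's candidate lemma (c) = (KMONO) (MINE-1.md §40(7)) asserted that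
`X ↦ K_X` is antitone: `K_X ≥ K_{X ∪ W}` whenever `s`, the marks of `F, G` and `X` avoid `W`.

This file checks in the kernel that (c) is FALSE.  Witness: vertices `0..5`, root `s = 0`,
avoided `t = 1`, `W = {5}` with `5` a pendant vertex at `2`; edges and weights

  `{0,1}: 3/4, {0,2}: 9/10, {0,3}: 9/10, {0,4}: 9/10, {1,4}: 1/10, {2,3}: 1/2, {2,4}: 1/2, {2,5}: 1/2`;

`F = 1[4 ∈ C_s]`, `G = 1[3 ∈ C_s]`.  With all weights in units of `1/20` every mass below is an
integer multiple of `20^{-8}` (`N = 20^8 = 25 600 000 000`):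

  `N·P(R_t) = 5 793 760 000`, `N·E[F;R_t] = 5 456 160 000`, `N·E[G;R_t] = 5 487 840 000`,
  `N·E[FG;R_t] = 5 171 040 000`; with `R' = R_{t,5}`: `2 985 760 000`, `2 799 360 000`,
  `2 816 640 000`, `2 643 840 000`;

  `K_t = 67311/579376000 ≈ 1.1618·10⁻⁴ < K_{t,5} = 17739/149288000 ≈ 1.1882·10⁻⁴`.

The eight masses are established by `decide +kernel` (a sum over the `2^8` edge configurations,
clusters by six expansion steps of a bitmask), the inequality by `norm_num`.  Mechanism (exact
identity, MINE-1.md §41(2)): for `w` pendant at `u` with weight `p_w`,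
`K_X − K_{X∪w} = P(R_X)·p·p_w·[c₁ + δ_Fδ_G (1−p)²/(1 − p·p_w)]` with `p = P(u ∈ C_s | R_X)`,
`c₁ = Cov(F,G | u ∈ C_s, R_X) = −5.9·10⁻⁵ < 0` here — the hit-centred form `c₁ + (1−p)²δ_Fδ_G` is
negative although `c₁ + (1−p)δ_Fδ_G > 0`.  Three independent exact implementations agree
(perc30.py, witness_c_code2.py, masses.py in mining/mine-1/code/g30/).
-/

namespace Summit.Ventures.PercRepro2.KMonoCounterexample

/-- An undirected edge `{u, v}` open with probability `w / 20`. -/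
structure UEdge where
  u : Nat
  v : Nat
  w : Nat

/-- The eight edges of the witness graph on the vertices `0..5` (`5` pendant at `2`). -/
def edge : Nat → UEdge
  | 0 => ⟨0, 1, 15⟩   -- {0,1}, p = 3/4
  | 1 => ⟨0, 2, 18⟩   -- {0,2}, p = 9/10
  | 2 => ⟨0, 3, 18⟩   -- {0,3}, p = 9/10
  | 3 => ⟨0, 4, 18⟩   -- {0,4}, p = 9/10
  | 4 => ⟨1, 4, 2⟩    -- {1,4}, p = 1/10
  | 5 => ⟨2, 3, 10⟩   -- {2,3}, p = 1/2
  | 6 => ⟨2, 4, 10⟩   -- {2,4}, p = 1/2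
  | _ => ⟨2, 5, 10⟩   -- {2,5}, p = 1/2 (the pendant edge)

/-- Edge `i` is open in the configuration `c ∈ [0, 2^8)` iff bit `i` of `c` is set. -/
def isOpen (c i : Nat) : Bool := c.testBit i

/-- Product Bernoulli weight of the configuration `c`, in units of `20^{-8}`. -/
def wt (c : Nat) : Nat :=
  (List.range 8).foldl (fun acc i => acc * (if isOpen c i then (edge i).w else 20 - (edge i).w)) 1

/-- Vertex sets are bitmasks over `0..5`; `mem S x` is `x ∈ S`. -/
def mem (S x : Nat) : Bool := S.testBit x

/-- One expansion step of a vertex set along the open edges. -/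
def step (c S : Nat) : Nat :=
  (List.range 8).foldl (fun S i =>
    let e := edge i
    if isOpen c i && (mem S e.u || mem S e.v) then S ||| (1 <<< e.u) ||| (1 <<< e.v) else S) S

/-- `n`-fold iteration of `step c`. -/
def iter (c : Nat) : Nat → Nat → Nat
  | 0, S => S
  | n + 1, S => iter c n (step c S)

/-- The open cluster `C_s` of the root `s = 0` (six steps suffice on six vertices). -/
def cluster (c : Nat) : Nat := iter c 6 1

/-- The avoidance event `R_t = {1 ∉ C_s}`. -/
def R (c : Nat) : Bool := !(mem (cluster c) 1)
/-- The avoidance event `R_{t,w} = {1 ∉ C_s ∧ 5 ∉ C_s}`. -/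
def R' (c : Nat) : Bool := R c && !(mem (cluster c) 5)
/-- `F = 1[4 ∈ C_s]`. -/
def F (c : Nat) : Bool := mem (cluster c) 4
/-- `G = 1[3 ∈ C_s]`. -/
def G (c : Nat) : Bool := mem (cluster c) 3

/-- `20^8 · P(E)` for a configuration predicate `E`. -/
def mass (E : Nat → Bool) : Nat := (List.range 256).foldl (fun a c => if E c then a + wt c else a) 0

/-- Total mass `20^8` (sanity: the weights sum to one). -/
theorem total_mass : mass (fun _ => true) = 20 ^ 8 := by decide +kernel

/-- `20^8 · P(R_t)`. -/
theorem mass_R : mass R = 5793760000 := by decide +kernel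
/-- `20^8 · E[F; R_t]`. -/
theorem mass_FR : mass (fun c => R c && F c) = 5456160000 := by decide +kernel
/-- `20^8 · E[G; R_t]`. -/
theorem mass_GR : mass (fun c => R c && G c) = 5487840000 := by decide +kernel
/-- `20^8 · E[FG; R_t]`. -/
theorem mass_FGR : mass (fun c => R c && F c && G c) = 5171040000 := by decide +kernel
/-- `20^8 · P(R_{t,5})`. -/
theorem mass_R' : mass R' = 2985760000 := by decide +kernel
/-- `20^8 · E[F; R_{t,5}]`. -/
theorem mass_FR' : mass (fun c => R' c && F c) = 2799360000 := by decide +kernel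
/-- `20^8 · E[G; R_{t,5}]`. -/
theorem mass_GR' : mass (fun c => R' c && G c) = 2816640000 := by decide +kernel
/-- `20^8 · E[FG; R_{t,5}]`. -/
theorem mass_FGR' : mass (fun c => R' c && F c && G c) = 2643840000 := by decide +kernel

/-- The unnormalised conditional slack `K_X = E[FG; R_X] − E[F; R_X]·E[G; R_X]/P(R_X)` from the
masses of `R_X`, `F ∧ R_X`, `G ∧ R_X`, `FG ∧ R_X` (rational, in probability units). -/
def slack (mR mF mG mFG : Nat) : ℚ := (mFG : ℚ) / 20 ^ 8 - (mF : ℚ) * mG / (mR * 20 ^ 8)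

/-- `K_t = 67311/579376000`. -/
theorem slack_t :
    slack (mass R) (mass (fun c => R c && F c)) (mass (fun c => R c && G c))
      (mass (fun c => R c && F c && G c)) = 67311 / 579376000 := by
  rw [mass_R, mass_FR, mass_GR, mass_FGR]; unfold slack; norm_num

/-- `K_{t,5} = 17739/149288000`. -/
theorem slack_tw :
    slack (mass R') (mass (fun c => R' c && F c)) (mass (fun c => R' c && G c))
      (mass (fun c => R' c && F c && G c)) = 17739 / 149288000 := by
  rw [mass_R', mass_FR', mass_GR', mass_FGR']; unfold slack; norm_num

/-- **(c)/(KMONO) is false**: on the witness graph `K_t < K_{t,5}` — enlarging the avoided set by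
the pendant vertex `5` INCREASES the unnormalised conditional slack of `(F, G) = (1[4 ∈ C_s], 1[3 ∈ C_s])`. -/
theorem kmono_false :
    slack (mass R) (mass (fun c => R c && F c)) (mass (fun c => R c && G c))
        (mass (fun c => R c && F c && G c)) <
      slack (mass R') (mass (fun c => R' c && F c)) (mass (fun c => R' c && G c))
        (mass (fun c => R' c && F c && G c)) := by
  rw [slack_t, slack_tw]; norm_num

/-- Both slacks are positive (BHK positive association holds on both sides, as it must). -/
theorem slacks_pos :
    (0 : ℚ) < 67311 / 579376000 ∧ (0 : ℚ) < 17739 / 149288000 := by norm_num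

end Summit.Ventures.PercRepro2.KMonoCounterexample
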